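import Summits.QuantumFields.BalabanUV.T4Continuum.Spine.NE1p.DressedSmallFieldInnerLink
import Summits.QuantumFields.BalabanUV.T4Continuum.Spine.NE1p.DressedSmallFieldFamiliesWitness

/-!
# T⁴ programme, spine estimate NE1′ (node O3b/H2) — WITNESS «THE SECOND RESUMMATION STEP FIRES — THE UNCOVERED CUBE IS PAID BY A
# BOND»: the owner's N0u END `attachedPart_locE_le_of_coresAt_pencil_innerLabels` (`Spine/NE1p/DressedSmallFieldInnerCount`) APPLIED
# ONCE BY NAME — its first DECIDED applier — on a toy whose term index IS the set of admissible inner labels `⟨W, (𝐃, P)⟩` of the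
# footprint; at the unit cube the label with an UNCOVERED cube and ONE bond is LIVE

Cell `pub-balaban`, sub-cell `t4`, row NE1′ formalisation crew (`t4/formal/NE1p/LEAVES.md` row W50 ∕ DAG N29zzr; INTENT HOME/CLAIMS.log l.19461, BOOKED typer R-T125 (iii) l.19575; X163 its read),
unit `b2b-balaban-t4-ne1p-formalise-leaf-06` (gen 11); PART 1 of 2 (D1).  ADDITIVE — imports the crew's `Spine/NE1p/DressedSmallFieldInnerLink` (leaf-07
g16; → the owner's N0u `DressedSmallFieldInnerCount` → N0t → N0s → N0r; b13's `B13FamilySum` ∕ `B13` in the cone) and W45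
`Spine/NE1p/DressedSmallFieldFamiliesWitness` (leaf-10 g10; → W41 → W35 → W33 → W24, row NE5's `Support/B13HistWitness`) ONLY; toy DATA
`def`s + theorems; 0 `def … : Prop`, 0 cite, 0 sorry, 0 `attribute`; nothing of N0u ∕ N0s ∕ InnerLink ∕ W45 ∕ W41 ∕ W35 ∕ W33 ∕ W24 ∕
b13 ∕ pv22 is restated — their declarations are used BY NAME.

WHY.  N0u supplies the SECOND of print's four resummation steps ([Balaban1988RGII] p. 17 «Next, we sum over Y₀, P determining a fixed
Z₀», (2.31)–(2.34) KIND) in kernel, table-blind: its END indexes the cores of a polymer by INNER LABELS `⟨W, (𝐃, P)⟩` — uncovered cubes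
`W = Z₀∖Y₀`, a family `𝐃` covering the rest, a bond set `P ⊆ bondsOf W` with `#W ≤ 2·#P` — and discharges the count by `innerCount_le_decay`
(P-step `sum_bondSets_le`, fibre split, (2.34)'s `Σ_{W⊆C₀} u^{#W} ≤ e^{#C₀u}`) under the rate bookkeeping `Rkp ≤ R − c₁u`, given the
(2.27)∘(2.32) link (leaf-07's `link_torus`: `c₃₂ = 5` on pv22's torus).  Every landed witness indexes its cores by `Unit`, `Bool` or
covering families (W45): the fibres `W ≠ ∅` — the P-step and the (2.34)-step — have NO decided inhabitant.  Here, on `tgeometry 4 N`, `foot := id`: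
* §1 OUR NUMERALS: count rate `RI := 2κ₀ + 3` ONE UNIT above the step rate `Rkp := 2κ₀ + 2` (W24's `hrate_torus`), bond letters `t := 1`,
  `sI := e^{−(5·RI+1)}∕64`, bonds READ AS CUBES (`bondsOf W := W`, `b₀ := 1`: `hb₀` WITH EQUALITY) ⇒ `c₁·u = 64·e^{5RI}·sI·e = 1`
  (`c₁u_eq_one`) and N0u's `hRR` holds WITH EQUALITY (`hRR_I_eq`);
* §2 IN KERNEL, LOCATED: `coveringFamilies_emptyFootprint` (`= {∅}` on any (2.11)-geometry); the index of record `termsI Z` := ALL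
  admissible inner labels (N0u's `hadm` with EQUALITY — the full index of `innerCount_le`); **`sum_termsI_X₀`** — at the unit cube a
  sum over `termsI X₀` has EXACTLY TWO terms: the COVERED label `⟨∅, ({X₀}, ∅)⟩` (N0s §4's one family, W45's `coveringFamilies_unitCube`)
  and the UNCOVERED label `⟨{0}, (∅, {0})⟩` (`W = {0}`, the empty family, ONE bond `P = {0}`: `#W ≤ 2·#P` as `1 ≤ 2`); `card_termsI_X₀ = 2`;
* §3 THE LABEL-INDEXED CORES (toy DATA): one W33 core `coreW (cI l) r` per label, `cI l := (cM r∕2)·pI(𝐃)·(sI²·1)^{#P}` with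
  `pI 𝐃 := Π_{Y∈𝐃} α₆F·e^{−δFκF d(Y)}·e^{−RI(d(Y)+5)}` — N0u's majorant SHAPE BY CHOICE, so `hAmp_I` holds by W41's `budget_half`
  (`A₀ := 0`, `A₁ := A∕4`, `ϱ := 2`); `cI_uncovered = (cM r∕2)·sI²` — the bond letter keeps the uncovered label alive (`t := 0` kills it);
* §4 **`innerEnd_fires`** — N0u's END ONCE BY NAME (`D = Dk := tsys 4 N`, `G = Gk := tgeometry 4 N`, `foot := id`, `hmono := le_rfl`,
  W33's `ctr0`∕`hroom0`, NE5's toy letters `(1, 0, 1)` INLINE, `hlink := link_torus 4 N` at `c₃₂ := 5`, W45's `hκ_F`∕`h229_F`∕`hsmall_F`,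
  `hRR_I`, `hb₀_I`, `hadm_I`, `hAmp_I`); conclusion LITERAL; closed form `≤ K₀(64,8)`;
* PART 2 `Spine/NE1p/DressedSmallFieldInnerLabelsWitnessLive` ((D1) declared at PROTOTYPE, imports THIS file only) — GENUINE: `actI_X₀` (TWO terms in closed
  form), `uncoveredTerm_live` (the uncovered label's OWN term reads the table), `actI_live`, **`innerEnd_live`** (the END's bounded quantity
  is NOT zero, W24's `exp_locE_cube`).

WORDING OF RECORD (crew row W50 = DAG N29zzr, typer R-T125 (iii): the holder's title of l.19461 + the typer's rider ADOPTED verbatim): «bonds READ AS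
cubes (`Bnd := TPt 4 N`, `bondsOf W := W`, `b₀ := 1`), `foot = id`, «terms = all admissible inner labels» are OUR toy choices; the (2.27)∘(2.32) link is
S40.1's theorem BY NAME, never restated; if S40.1 slips the witness WAITS».

HONEST FRAMING.  A DECIDED TOY ([folklore]; 0 sorry; 0 citations; no `def … : Prop` — the `def`s are toy DATA and two numerals; `Label` is a
type abbreviation).  The cores are THEOREM-backed instances of the cell's typed FORMAT of (2.14) (`B13TermParamGaussianBi.BiCore`) over row
NE5's TOY frame — NOT Bałaban's (2.14) terms, NOT rows NE2∕NE3's Gaussian data, NOT the substrate's `slotsOfRecord`; «bonds = cubes»,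
`foot = id` and «terms = all admissible inner labels» are OUR toy choices — (B1b) is NOT claimed for Bałaban's densities; (B3)'s amplitude
clause is MET because the weights are CHOSEN as N0u's majorant — (B3-amp) stays UNPRINTED for Bałaban's cores (GAPS G-ne9p2-5); (B3-count)'s
second step is N0u §2's kernel count, its link leaf-07's kernel (2.27)-lemma on pv22's CONSTRUCTED torus; `2κ₀+3`, `e^{−(5RI+1)}∕64`, `A∕4`
are OUR numerals over pv22's located letters `κ₀ = 64 log 162`, `K₀(64,8)`, `c₁ = 64`, `ν = 9`; print's `4`∕`5`∕`17`∕«½M⁻⁴|Z₀∖Y₀|» and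
the shape `α₆e^{−δκd}·e^{−R(d+5)}·(s²t)^{#P}` are N0u's DISPLAYED (2.27)∕(2.31)–(2.34) print-shape, TYPE only — no numeral of
[Balaban1988RGII] is asserted as a fact about Bałaban's densities; 0 binders instantiated on Bałaban's densities; no wall item; wall v1.7
(T4-DAG v44) does NOT move; R-t4r2-Q2 NOT met thereby; NE1′ ⇐ the named binders — NOT proved, NOT printed; spine PROVED 0∕9; count 9
unchanged.  Rung (B)+1 on ONE finite four-torus — NOT infinite volume, NOT a mass gap, NOT OS on ℝ⁴, NOT Clay.  HONEST DEPENDENCY: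
continuum YM on T⁴ ⇐ BetaPertH ∧ nine spine estimates (0/9 proved); BetaPertH ⇐ (D1) ∧ (D4) ∧ CAP+tail; G-an2-4 gates asym, D1 and NE2/3/4.
-/

noncomputable section

namespace Summit.QuantumFields.BalabanUV.T4Continuum.NE1p.DressedSmallFieldInnerLabelsWitness

open Set Metric MeasureTheory Complex
open scoped BigOperators
open Literature.MathematicalPhysics.QuantumFieldTheory.Balaban1983to89
open Literature.MathematicalPhysics.QuantumFieldTheory.Balaban1983to89.B12TreeDecay (K₀ K₀_pos)
open Literature.MathematicalPhysics.QuantumFieldTheory.Balaban1983to89.B13Resummation (locE Geometry)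
open Literature.MathematicalPhysics.QuantumFieldTheory.Balaban1983to89.B13FamilySum (coveringFamilies mem_coveringFamilies)
open Literature.MathematicalPhysics.QuantumFieldTheory.Balaban1983to89.TreeLengthTorus (TPt TDom tsys torusTreeLen)
open Literature.MathematicalPhysics.QuantumFieldTheory.Balaban1983to89.TreeLengthTorusGeometry (tgeometry TTouch)
open Summit.QuantumFields.BalabanUV.T4Continuum.B13HistMeasurable (B13HistM)
open Summit.QuantumFields.BalabanUV.T4Continuum.B13HistWitness (toyFrame)
open Summit.QuantumFields.BalabanUV.T4Continuum.B13TermParamGaussianBi (BiCore)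
open Summit.QuantumFields.BalabanUV.T4Continuum.NE1p.DressedSmallFieldTorusWitness (X₀ X₀_val hrate_torus)
open Summit.QuantumFields.BalabanUV.T4Continuum.NE1p.DressedSmallFieldGeometry (torus_consts)
open Summit.QuantumFields.BalabanUV.T4Continuum.NE1p.DressedSmallFieldGeometryFaces (K₀_four)
open Summit.QuantumFields.BalabanUV.T4Continuum.NE1p.DressedSmallFieldCoresWitness (E1 liveTable norm_liveTable_le coreW N₁_coreW ctr0
  hroom0 Acst Acst_pos)
open Summit.QuantumFields.BalabanUV.T4Continuum.NE1p.DressedSmallFieldCoresMassWitness (letterMass_coreW cM cM_pos)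
open Summit.QuantumFields.BalabanUV.T4Continuum.NE1p.DressedSmallFieldDepCoresWitness (budget_half)
open Summit.QuantumFields.BalabanUV.T4Continuum.NE1p.DressedSmallFieldFamiliesWitness (δF κF α₆F δF_mul_κF_pos α₆F_pos α₆F_le_one
  hκ_F h229_F hsmall_F coveringFamilies_unitCube)
open Summit.QuantumFields.BalabanUV.T4Continuum.NE1p.DressedSmallFieldInnerCount (attachedPart_locE_le_of_coresAt_pencil_innerLabels)
open Summit.QuantumFields.BalabanUV.T4Continuum.NE1p.DressedSmallFieldInnerLink (link_torus)

section Torus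
variable (N : ℕ) [NeZero N]

/-! ## §1 OUR NUMERALS: the count rate one unit above the step rate, the bond letter, and N0u's rate bookkeeping WITH EQUALITY -/

/-- THE COUNT RATE (toy numeral): `RI := 2κ₀ + 3` — one unit above the step rate `Rkp = 2κ₀ + 2` of W24's `hrate_torus`; the unit is
what the entropy `c₁u` of the uncovered cubes costs (N0u's `hRR`). [folklore] -/
def RI : ℝ := 2 * (tgeometry 4 N).κ₀ + 3

/-- THE BOND LETTER (toy numeral): `sI := e^{−(5·RI + 1)}∕64`, so that `c₁·u = 64·e^{5RI}·sI·e^{1·1} = 1` at `c₃₂ = 5`, `b₀ = t = 1`.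
[folklore] -/
def sI : ℝ := Real.exp (-(RI N * 5 + 1)) / 64

/-- `0 < RI`. [arith] -/
theorem RI_pos : 0 < RI N := by unfold RI; linarith [(tgeometry 4 N).κ₀_nonneg]

/-- `0 < sI`. [arith] -/
theorem sI_pos : 0 < sI N := by unfold sI; positivity

/-- `sI ≤ 1` (`e^{−(5RI+1)} ≤ 1 ≤ 64`). [arith] -/
theorem sI_le_one : sI N ≤ 1 := by
  unfold sI
  have h : Real.exp (-(RI N * 5 + 1)) ≤ 1 := Real.exp_le_one_iff.2 (by linarith [RI_pos N])
  linarith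

/-- **THE ENTROPY OF THE UNCOVERED CUBES COSTS EXACTLY ONE UNIT OF RATE**: `c₁·(e^{RI·5}·sI·e^{1·1}) = 1` at pv22's `c₁ = 64`
(`torus_consts`). [arith] -/
theorem c₁u_eq_one : (tgeometry 4 N).c₁ * (Real.exp (RI N * 5) * sI N * Real.exp (1 * 1)) = 1 := by
  rw [(torus_consts N).2.2]
  unfold sI
  have h : Real.exp (RI N * 5) * Real.exp (-(RI N * 5 + 1)) * Real.exp (1 * 1) = 1 := by
    rw [← Real.exp_add, ← Real.exp_add, show RI N * 5 + -(RI N * 5 + 1) + 1 * 1 = 0 by ring, Real.exp_zero]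
  linear_combination h

/-- **N0u's RATE BOOKKEEPING `hRR` WITH EQUALITY**: `RI − c₁·u = 2κ₀ + 2 = Rkp`. [arith] -/
theorem hRR_I_eq : RI N - (tgeometry 4 N).c₁ * (Real.exp (RI N * 5) * sI N * Real.exp (1 * 1)) = 2 * (tgeometry 4 N).κ₀ + 2 := by
  rw [c₁u_eq_one]; unfold RI; ring

/-- … hence N0u's binder `hRR : Rkp ≤ R − Gk.c₁·(e^{R·c₃₂}·s·e^{b₀·t})` at `(Rkp, R, c₃₂, s, b₀, t) = (2κ₀+2, RI, 5, sI, 1, 1)`. [arith] -/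
theorem hRR_I : 2 * (tgeometry 4 N).κ₀ + 2 ≤ RI N - (tgeometry 4 N).c₁ * (Real.exp (RI N * 5) * sI N * Real.exp (1 * 1)) :=
  (hRR_I_eq N).ge

omit [NeZero N] in
/-- **BONDS READ AS CUBES** (OUR toy choice `bondsOf W := W`, `b₀ := 1`): N0u's bonds-per-cube clause `hb₀` WITH EQUALITY. [arith] -/
theorem hb₀_I : ∀ W : Finset (TPt 4 N), (W.card : ℝ) ≤ 1 * W.card := fun W => by rw [one_mul]

/-! ## §2 LOCATED, IN KERNEL: the admissible inner labels of a unit cube are exactly TWO -/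

/-- **THE FAMILIES COVERING THE EMPTY FOOTPRINT ARE `{∅}`** [folklore finite-set fact]: on any (2.11)-geometry (footprints non-empty) a
family whose footprints unite to `∅` is empty, and the empty family covers `∅` — the 𝐃-slot of a label whose cubes are ALL uncovered. -/
theorem coveringFamilies_emptyFootprint {Dk : LocDomainSys} {CubeK : Type} [DecidableEq CubeK] (Gk : Geometry Dk CubeK) :
    coveringFamilies (Finset.univ : Finset Dk.Dom) Gk.cubes ∅ = {∅} := by
  ext Df
  rw [mem_coveringFamilies, Finset.mem_singleton]
  constructor
  · rintro ⟨-, hU⟩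
    rw [Finset.eq_empty_iff_forall_notMem]
    intro Y hY
    obtain ⟨c, hc⟩ := Gk.cubes_nonempty Y
    have hcU : c ∈ Df.biUnion Gk.cubes := Finset.mem_biUnion.2 ⟨Y, hY, hc⟩
    rw [hU] at hcU
    exact Finset.notMem_empty c hcU
  · rintro rfl
    exact ⟨Finset.empty_subset _, Finset.biUnion_empty⟩

/-- THE INNER-LABEL TYPE of the torus (a type abbreviation, no data): `⟨W, (𝐃, P)⟩` — uncovered cubes, a family of torus domains, a bond
set; bonds READ AS CUBES (`Bnd := TPt 4 N`). [folklore] -/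
abbrev Label : Type := Σ _ : Finset (TPt 4 N), Finset (TDom 4 N) × Finset (TPt 4 N)

open Classical in
/-- THE TERM INDEXING OF RECORD (toy DATA): the terms of a polymer `Z` are ALL admissible inner labels of its footprint read one scale
down AT THE SAME SCALE (`foot := id`): `W ⊆ Z`, `𝐃` covering `Z ∖ W` by torus domains, `P ⊆ bondsOf W = W`, `#W ≤ 2·#P` — N0u's `hadm`
with EQUALITY (the admissible set of `innerCount_le` itself). [folklore] -/
def termsI (Z : TDom 4 N) : Finset (Label N) :=
  (Z.1).powerset.sigma fun W =>
    coveringFamilies (Finset.univ : Finset (TDom 4 N)) (tgeometry 4 N).cubes (Z.1 \ W) ×ˢ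
      W.powerset.filter (fun P => W.card ≤ 2 * P.card)

/-- **N0u's ADMISSIBILITY `hadm` HOLDS ON THE INDEX OF RECORD** (membership unpacking; `foot := id`, `bondsOf := id`). [folklore] -/
theorem hadm_I : ∀ Z : (tsys 4 N).Dom, ∀ l ∈ termsI N Z, l.1 ⊆ (tgeometry 4 N).cubes Z ∧
    l.2.1 ∈ coveringFamilies Finset.univ (tgeometry 4 N).cubes ((tgeometry 4 N).cubes Z \ l.1) ∧
      l.2.2 ⊆ l.1 ∧ l.1.card ≤ 2 * l.2.2.card := by
  classical
  intro Z l hl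
  unfold termsI at hl
  obtain ⟨hW, hq⟩ := Finset.mem_sigma.1 hl
  obtain ⟨hD, hP⟩ := Finset.mem_product.1 hq
  obtain ⟨hP1, hP2⟩ := Finset.mem_filter.1 hP
  exact ⟨Finset.mem_powerset.1 hW, hD, Finset.mem_powerset.1 hP1, hP2⟩

omit [NeZero N] in
/-- The power set of the one cube: `{0}.powerset = {∅, {0}}` — the two fibres `W = ∅` (covered) and `W = {0}` (uncovered). [folklore] -/
theorem powerset_unitCube : (({0} : Finset (TPt 4 N))).powerset = {∅, {0}} := by
  ext s
  rw [Finset.mem_powerset, Finset.subset_singleton_iff, Finset.mem_insert, Finset.mem_singleton]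

open Classical in
/-- **AT THE UNIT CUBE A SUM OVER THE INNER LABELS HAS EXACTLY TWO TERMS** [decided, kernel]: the COVERED label `⟨∅, ({X₀}, ∅)⟩` (fibre
`W = ∅`: the one covering family `{X₀}` of W45's `coveringFamilies_unitCube`, no bond) and the UNCOVERED label `⟨{0}, (∅, {0})⟩` (fibre
`W = {0}`: the empty family covers `∅` — `coveringFamilies_emptyFootprint` — and the ONE bond `{0}` pays the uncovered cube, `1 ≤ 2·1`;
the empty bond set is NOT admissible, `1 ≤ 2·0` fails) — the two-fibre split of N0u's `innerCount_le` (`Finset.sum_sigma`) read off. [folklore] -/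
theorem sum_termsI_X₀ {M : Type*} [AddCommMonoid M] (f : Label N → M) :
    ∑ l ∈ termsI N (X₀ N), f l = f ⟨∅, ({X₀ N}, ∅)⟩ + f ⟨{0}, (∅, {0})⟩ := by
  unfold termsI
  rw [Finset.sum_sigma, X₀_val, powerset_unitCube, Finset.sum_insert (by simp), Finset.sum_singleton]
  -- fibre `W = ∅`: the footprint `{0} ∖ ∅ = {0}` is covered by `{X₀}` only; the only bond set is `∅` (admissible: `0 ≤ 0`)
  have hcov : coveringFamilies (Finset.univ : Finset (TDom 4 N)) (tgeometry 4 N).cubes (({0} : Finset (TPt 4 N)) \ ∅) = {{X₀ N}} := by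
    rw [Finset.sdiff_empty]; exact coveringFamilies_unitCube N
  have hP0 : (∅ : Finset (TPt 4 N)).powerset.filter (fun P => (∅ : Finset (TPt 4 N)).card ≤ 2 * P.card) = {∅} := by
    rw [Finset.powerset_empty]; exact Finset.filter_true_of_mem fun P _ => by simp
  -- fibre `W = {0}`: the footprint `∅` is covered by the empty family only; the admissible bond sets are `{{0}}`
  have hunc : coveringFamilies (Finset.univ : Finset (TDom 4 N)) (tgeometry 4 N).cubes (({0} : Finset (TPt 4 N)) \ {0}) = {∅} := by
    rw [Finset.sdiff_self]; exact coveringFamilies_emptyFootprint (tgeometry 4 N)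
  have hP1 : (({0} : Finset (TPt 4 N))).powerset.filter (fun P => (({0} : Finset (TPt 4 N))).card ≤ 2 * P.card) = {{0}} := by
    rw [powerset_unitCube]
    ext P
    simp only [Finset.mem_filter, Finset.mem_insert, Finset.mem_singleton, Finset.card_singleton]
    constructor
    · rintro ⟨rfl | rfl, h⟩
      · simp at h
      · rfl
    · rintro rfl; exact ⟨Or.inr rfl, by simp⟩
  rw [hcov, hP0, hunc, hP1, Finset.singleton_product_singleton, Finset.singleton_product_singleton, Finset.sum_singleton,
    Finset.sum_singleton]

open Classical in
/-- **THE UNIT CUBE HAS EXACTLY TWO ADMISSIBLE INNER LABELS.** [folklore] -/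
theorem card_termsI_X₀ : (termsI N (X₀ N)).card = 2 := by
  rw [Finset.card_eq_sum_ones, sum_termsI_X₀]

/-! ## §3 THE LABEL-INDEXED CORES (toy DATA): one W33 core per inner label, weighted by N0u's majorant -/

/-- THE PER-FAMILY FACTOR AT THE COUNT RATE (toy DATA): `pI 𝐃 := Π_{Y∈𝐃} (α₆F·e^{−δF κF d(Y)}·e^{−RI(d(Y)+5)})` — LITERALLY the product
displayed in N0u's `hAmp` at W45's numerals `α₆F`∕`δF`∕`κF` and our rate `RI` (print's (2.27)∕(2.28) SHAPE, TYPE only). [folklore] -/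
def pI (Df : Finset (TDom 4 N)) : ℝ :=
  ∏ Y ∈ Df, (α₆F * Real.exp (-(δF * κF * (tsys 4 N).dj Y)) * Real.exp (-(RI N * ((tsys 4 N).dj Y + 5))))

/-- `0 < pI 𝐃`. [arith] -/
theorem pI_pos (Df : Finset (TDom 4 N)) : 0 < pI N Df :=
  Finset.prod_pos fun Y _ => by have := α₆F_pos; positivity

/-- `pI 𝐃 ≤ 1` (every factor is `≤ 1`). [arith] -/
theorem pI_le_one (Df : Finset (TDom 4 N)) : pI N Df ≤ 1 := by
  refine Finset.prod_le_one (fun Y _ => by have := α₆F_pos; positivity) fun Y _ => ?_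
  have hd := (tsys 4 N).dj_nonneg Y
  have hR := (RI_pos N).le
  have h1 : Real.exp (-(δF * κF * (tsys 4 N).dj Y)) ≤ 1 :=
    Real.exp_le_one_iff.2 (neg_nonpos.2 (mul_nonneg δF_mul_κF_pos.le hd))
  have h2 : Real.exp (-(RI N * ((tsys 4 N).dj Y + 5))) ≤ 1 := Real.exp_le_one_iff.2 (neg_nonpos.2 (by positivity))
  exact mul_le_one₀ (mul_le_one₀ α₆F_le_one (Real.exp_pos _).le h1) (Real.exp_pos _).le h2

/-- The empty family carries the factor `1`. [arith] -/
@[simp] theorem pI_empty : pI N ∅ = 1 := Finset.prod_empty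

variable (r : ℝ) (hr : 0 ≤ r)

/-- THE LABEL-DEPENDENT CAUCHY WEIGHT (toy DATA): `cI l := (cM r∕2)·(pI 𝐃·(sI²·1)^{#P})` — W35's `cM` times N0u's MAJORANT of the
label BY CHOICE (family factor × bond letters `(s²t)^{#P}` at `t = 1`). [folklore] -/
def cI (l : Label N) : ℝ := cM r / 2 * (pI N l.2.1 * (sI N ^ 2 * 1) ^ l.2.2.card)

/-- `0 < cI l`. [arith] -/
theorem cI_pos (l : Label N) : 0 < cI N r l := by
  unfold cI; have := cM_pos r; have := pI_pos N l.2.1; have := sI_pos N; positivity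

/-- The majorant of a label is at most one (`pI ≤ 1`, `sI² ≤ 1`). [arith] -/
theorem maj_le_one (l : Label N) : pI N l.2.1 * (sI N ^ 2 * 1) ^ l.2.2.card ≤ 1 := by
  have hs : sI N ^ 2 * 1 ≤ 1 := by rw [mul_one]; exact pow_le_one₀ (sI_pos N).le (sI_le_one N)
  exact mul_le_one₀ (pI_le_one N _) (by have := sI_pos N; positivity) (pow_le_one₀ (by have := sI_pos N; positivity) hs)

/-- **THE UNCOVERED LABEL's WEIGHT IS THE BOND LETTER**: `cI ⟨{0}, (∅, {0})⟩ = (cM r∕2)·sI²` (empty family, ONE bond) — positive BECAUSE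
`t = 1 > 0`; at `t = 0` the label would be dead. [arith] -/
theorem cI_uncovered : cI N r ⟨{0}, (∅, {0})⟩ = cM r / 2 * sI N ^ 2 := by
  unfold cI; rw [pI_empty, Finset.card_singleton, pow_one, mul_one, one_mul]

/-- The covered label's weight: `cI ⟨∅, ({X₀}, ∅)⟩ = (cM r∕2)·pI {X₀}` (no bond). [arith] -/
theorem cI_covered : cI N r ⟨∅, ({X₀ N}, ∅)⟩ = cM r / 2 * pI N {X₀ N} := by
  unfold cI; rw [Finset.card_empty, pow_zero, mul_one]

/-- **THE LABEL-INDEXED CORE FAMILY** (toy DATA): at the label `l` W33's one-label core `coreW` (BY NAME) at the weight `cI l` — one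
`BiCore toyFrame (fun _ : Unit => 0) ℂ Unit E1` per `(k, l, X)`. [folklore] -/
def GI : ∀ (_ : ℕ) (_ : Label N), ℕ → BiCore toyFrame (fun _ : Unit => (0 : ℕ)) ℂ Unit E1 :=
  fun _ l _ => coreW (cI N r l) r hr

/-- The core at `(k, l, X)`. [folklore] -/
@[simp] theorem GI_apply (k : ℕ) (l : Label N) (X : ℕ) : GI N r hr k l X = coreW (cI N r l) r hr := rfl

open Classical in
/-- THE ACTIVITY OF RECORD (toy DATA): the sum of the label-indexed cores' terms over ALL admissible inner labels of the footprint, along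
the pencil `s ↦ 0 + s • liveTable` — so N0u's `hact` holds by `rfl` and `hscale` by `rfl` (`emb Z := k`). [folklore] -/
def actI (k : ℕ) (s : ℂ) (Z : TDom 4 N) : ℂ :=
  ∑ l ∈ termsI N Z, (GI N r hr k l k).termAt (0 : ℂ) ((0 : B13HistM toyFrame) + s • liveTable)

/-- **`hAmp` MET FOR EVERY SUB-POLYMER AND EVERY LABEL** [decided toy], in the LITERAL binder shape of N0u's END at NE5's toy letters
`(mq, bq, N₀) = (1, 0, 1)`, `ϱ = 2`, `R₀ = ‖0‖ + 2‖liveTable‖`, `A₀ = 0`, `A₁ = A∕4`: the core's letter mass times read-out growth is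
`maj(l)·|cM r∕2|·√(2π)·e^{r·2‖liveTable‖} ≤ maj(l)·A∕2 = (0 + 2·(A∕4))·maj(l)` (W35's `letterMass_coreW`, W41's `budget_half` BY NAME). [folklore] -/
theorem hAmp_I (k : ℕ) :
    ∀ Z : (tsys 4 N).Dom, (tgeometry 4 N).cubes Z ⊆ (tgeometry 4 N).cubes (X₀ N) → ∀ l ∈ termsI N Z,
      (GI N r hr k l k).lam.real univ *
          ((GI N r hr k l k).wB * (fun (_ : ℕ) (_ : Label N) (_ : ℕ) => (1 : ℝ)) k l k *
            Real.exp ((fun (_ : ℕ) (_ : Label N) (_ : ℕ) => (0 : ℝ)) k l k)) *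
          (Real.pi / ((fun (_ : ℕ) (_ : Label N) (_ : ℕ) => (1 : ℝ)) k l k / 2)) ^ (Module.finrank ℝ E1 / 2 : ℝ) *
        Real.exp ((GI N r hr k l k).N₁ * (‖(0 : B13HistM toyFrame)‖ + 2 * ‖liveTable‖)) ≤
      (0 + 2 * (Acst / 4)) * (pI N l.2.1 * (sI N ^ 2 * 1) ^ l.2.2.card) := by
  intro Z _ l _
  simp only [GI_apply]
  rw [letterMass_coreW, N₁_coreW, norm_zero, zero_add]
  have hp : 0 ≤ pI N l.2.1 * (sI N ^ 2 * 1) ^ l.2.2.card := by have := pI_pos N l.2.1; have := sI_pos N; positivity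
  have hT : 2 * ‖liveTable‖ ≤ 2 := by linarith [norm_liveTable_le]
  have hb := budget_half r hr hT
  unfold cI
  rw [abs_mul, abs_of_nonneg hp]
  calc |cM r / 2| * (pI N l.2.1 * (sI N ^ 2 * 1) ^ l.2.2.card) * Real.sqrt (2 * Real.pi) * Real.exp (r * (2 * ‖liveTable‖))
      = (pI N l.2.1 * (sI N ^ 2 * 1) ^ l.2.2.card) * (|cM r / 2| * Real.sqrt (2 * Real.pi) * Real.exp (r * (2 * ‖liveTable‖))) := by
        ring
    _ ≤ (pI N l.2.1 * (sI N ^ 2 * 1) ^ l.2.2.card) * (Acst / 2) := mul_le_mul_of_nonneg_left hb hp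
    _ = (0 + 2 * (Acst / 4)) * (pI N l.2.1 * (sI N ^ 2 * 1) ^ l.2.2.card) := by ring

/-! ## §4 THE END FIRES: N0u's inner-labels END applied ONCE BY NAME (its first decided applier), the link by leaf-07's `link_torus` -/

open Classical in
/-- **N0u's `attachedPart_locE_le_of_coresAt_pencil_innerLabels` FIRES** [decided toy]: step geometry AND scale-`k` geometry the torus
`(tsys 4 N, tgeometry 4 N)` (`foot := id`, `hmono := le_rfl` — the toy reads the scale-`k` catalogue at the step's own scale, (2.36) KIND
at factor `1`; it does NOT model the `L`-refinement), cores `GI` indexed by inner labels, W33's `ctr0`∕`hroom0`, NE5's toy letters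
INLINE, the pencil's two radius inequalities, `hscale`∕`hact` by `rfl`, W24's `hrate_torus` (`Rkp := 2κ₀+2`), W45's `hsmall_F`∕`hκ_F`∕
`h229_F`, bonds READ AS CUBES (`bondsOf := id`, `b₀ := 1`, `hb₀_I`), the count rate `R := RI`, `c₃₂ := 5` with the LINK SUPPLIED BY NAME
from leaf-07's `link_torus`, `s := sI`, `t := 1`, §1's `hRR_I`, `hadm_I`, `hAmp_I`, `hϱ : 2 ≤ 2`, `hϱA`.  Conclusion LITERAL. [folklore] -/
theorem innerEnd_fires (k : ℕ) :
    ‖locE (tgeometry 4 N).ι (tgeometry 4 N).cubes (actI N r hr k 1) ((tgeometry 4 N).cubes (X₀ N)) -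
        locE (tgeometry 4 N).ι (tgeometry 4 N).cubes (actI N r hr k 0) ((tgeometry 4 N).cubes (X₀ N))‖ ≤
      4 * (Real.exp 1 * (tgeometry 4 N).ν * (tgeometry 4 N).c₁ * (tgeometry 4 N).K₀ ^ 2) * (Acst / 4) *
        Real.exp (-(0 * (tsys 4 N).dj (X₀ N))) :=
  attachedPart_locE_le_of_coresAt_pencil_innerLabels (tsys 4 N) (tgeometry 4 N) (tgeometry 4 N) (GI N r hr)
    (Win := Set.univ) (ctr := ctr0) (ROp := fun _ => 1) (RHist := fun _ => 2) (R' := fun _ => 2)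
    (mq := fun _ _ _ => 1) (bq := fun _ _ _ => 0) (N₀ := fun _ _ _ => 1)
    hroom0 (fun _ _ _ _ _ _ _ => one_pos)
    (fun _ _ _ _ _ _ _ => ⟨fun _ _ => aestronglyMeasurable_const, fun _ => differentiableOn_const _, fun _ _ _ => by
      show ‖(1 : ℂ)‖ ≤ 1; rw [norm_one]⟩)
    (fun _ _ _ _ _ _ _ => ⟨fun _ _ => (Complex.measurable_ofReal.comp (measurable_snd.norm.pow_const 2)).aestronglyMeasurable,
      fun _ _ => differentiableOn_const _, fun _ _ _ v => by
        show 1 * ‖v‖ ^ 2 - 0 ≤ (((‖v‖ ^ 2 : ℝ) : ℂ)).re; rw [Complex.ofReal_re]; simp⟩)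
    (g := fun _ => 0) (Set.mem_univ _) (U := ()) (o := 0) (h₀ := 0) (w := liveTable) (ϱ := 2)
    (by show ‖(0 : ℂ) - 0‖ ≤ 1; simp)
    (by show ‖(0 : B13HistM toyFrame) - 0‖ + 2 * ‖liveTable‖ ≤ 2; rw [sub_zero, norm_zero, zero_add];
        linarith [norm_liveTable_le])
    (emb := fun _ => k) (fun _ => rfl) (terms := termsI N) (act := actI N r hr k) (fun _ _ _ => rfl)
    (A₀ := 0) (A₁ := Acst / 4) (Rkp := 2 * (tgeometry 4 N).κ₀ + 2) (r₁ := 0) (b₅ := 0) (X₀ := X₀ N)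
    le_rfl (by have := Acst_pos; positivity) le_rfl (by norm_num) (hrate_torus N) (hsmall_F N)
    (fun Z => Z) (fun _ => le_rfl) (fun W => W) (δ := δF) (κ := κF) (α₆ := α₆F) (R := RI N) (c₃₂ := 5) (b₀ := 1)
    (s := sI N) (t := 1) α₆F_pos.le (hκ_F N) (h229_F N) (sI_pos N).le (sI_le_one N) zero_le_one (hb₀_I N) (hRR_I N)
    (fun Z W hW Df hDf => link_torus 4 N Z W hW Df hDf) (hadm_I N) (hAmp_I N r hr k) le_rfl (by have := Acst_pos; linarith)

open Classical in
/-- … in CLOSED FORM: `≤ 4·(e·9·64·K₀(64,8)²)·(A∕4) = K₀(64,8)` (pv22's constants by `torus_consts`∕`K₀_four` BY NAME). [folklore] -/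
theorem innerEnd_fires_closed (k : ℕ) :
    ‖locE (tgeometry 4 N).ι (tgeometry 4 N).cubes (actI N r hr k 1) ((tgeometry 4 N).cubes (X₀ N)) -
        locE (tgeometry 4 N).ι (tgeometry 4 N).cubes (actI N r hr k 0) ((tgeometry 4 N).cubes (X₀ N))‖ ≤ K₀ 64 8 := by
  refine (innerEnd_fires N r hr k).trans (le_of_eq ?_)
  rw [(torus_consts N).1, (torus_consts N).2.2, K₀_four, zero_mul, neg_zero, Real.exp_zero, mul_one]
  unfold Acst
  have hK := K₀_pos (64 : ℝ) 8
  have he := Real.exp_pos 1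
  field_simp

end Torus

end Summit.QuantumFields.BalabanUV.T4Continuum.NE1p.DressedSmallFieldInnerLabelsWitness

end
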